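import Summits.AnomalousDissipation.AnomalousDissipation.Theorems.SawtoothPulseCascadeK1LocalisedCascadeTwistMoments
import Summits.AnomalousDissipation.AnomalousDissipation.Theorems.SawtoothPulseCascadeK1LocalisedCascadeMomentPeriodicCutoff

/-!
# K1loc, line `Spectral` / SeqCone — helper: THE PERIODIC-CELL TWIST MOMENT OF THE RESIDUAL SHEAR (S-B constants, (g2))

Helper file of the prover lane on the crux `K1LocalisedCascade` (stmt-AnomalousDissipation-19491), route
`SawtoothPulseCascade` (glue seat k1loc-p3, item (g2) of ad-k1loc-p2's 00:10:52Z list).  The residual-shear twist moments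
`Σ_q |q_j|‖𝓕(twist Q_res n ∘ x_j)(q)‖` (socket `hTw` of `…ConcreteStepHMoments.cascade_ledger_step_H_concrete′`) were so far
charged with the sup-norm bound `(2π|n|D₂ + (2π|n|D₁)²)/(4π√3)` (`…TwistMoments`), whose square term forces the cut-off widths
`ε_j` to decay like `Γ^{−j}`.  The residual `Q_res = −γ∫₀ D_{3ε}(U_j′)` is `1/N_j`-periodic (the slope defect is odd and
`U_j′` is `1/(2N_j)`-antiperiodic: `intervalIntegral_add_two_mul_eq_of_antiperiodic`), so the twist `e^{−2πinQ_res}` has axis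
spectrum on `N_jℤ` and `…AxisMomentPeriodic` applies: `tsum_abs_mul_norm_mFourierCoeff_twist_le_periodic` gives, for every
`Q ≥ 1`, `Σ_q |q_j|‖𝓕(twist Q n ∘ x_j)(q)‖ ≤ (1/2π)(√(2Q)·A₁ + A₂/(Nπ√(2Q)))` with `A₁ = 2π|n|D₁`, `A₂ = 2π|n|D₂ + A₁²`
(optimum `≈ (1/π)√(A₁A₂/(πN))` instead of `A₂/(4π√3)`); `twist_moment_residualShear_le_periodic` is the cascade corollary,
uniform on `|n| < R₀`.  No definitions; no statement about the stub.
[cite: Grafakos2014, Prop. 3.1.2 (5) and Prop. 3.2.7 (3)] [problem: turb]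
-/

-- `Summit.<Summit>.<Problem>`: single-conjunct summit, the duplicate namespace segment is deliberate.
set_option linter.dupNamespace false

noncomputable section

namespace Summit.AnomalousDissipation.AnomalousDissipation.Theorems.SawtoothPulseCascade.K1Slot

open MeasureTheory Set Filter Topology UnitAddTorus Complex
open Literature.Analysis Literature.Analysis.FunctionSpaces Literature.Analysis.FunctionSpaces.Torus
open Literature.Analysis.FluidPDE.SawtoothCascade Literature.Analysis.FluidPDE.SawtoothCascade.CascadeParams
open Summit.AnomalousDissipation.AnomalousDissipation.Theorems.SawtoothPulseCascade.K1Cutoff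
open scoped ContDiff

variable {d : Type*} [Fintype d] [DecidableEq d]

/-! ## A cell `L²` bound from a sup bound -/

omit [Fintype d] [DecidableEq d] in
/-- `∫_{(0,1]} ‖G‖² ≤ B²` when `‖G‖ ≤ B` pointwise (`G` continuous). [folklore] -/
theorem setIntegral_Ioc_norm_sq_le {G : ℝ → ℂ} (hG : Continuous G) {B : ℝ} (hB : ∀ y, ‖G y‖ ≤ B) :
    ∫ y in Ioc (0 : ℝ) 1, ‖G y‖ ^ 2 ≤ B ^ 2 := by
  have hfin : volume (Ioc (0 : ℝ) 1) ≠ ⊤ := by rw [Real.volume_Ioc]; exact ENNReal.ofReal_ne_top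
  have h1 : IntegrableOn (fun y => ‖G y‖ ^ 2) (Ioc (0 : ℝ) 1) volume :=
    (((continuous_norm.comp hG).pow 2).integrableOn_Icc (a := 0) (b := 1)).mono_set Ioc_subset_Icc_self
  have h2 : IntegrableOn (fun _ => B ^ 2) (Ioc (0 : ℝ) 1) volume := integrableOn_const (C := B ^ 2) hfin
  calc ∫ y in Ioc (0 : ℝ) 1, ‖G y‖ ^ 2 ≤ ∫ y in Ioc (0 : ℝ) 1, B ^ 2 :=
        setIntegral_mono_on h1 h2 measurableSet_Ioc fun y _ =>
          pow_le_pow_left₀ (norm_nonneg _) (hB y) 2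
    _ = B ^ 2 := by rw [setIntegral_const, Real.volume_real_Ioc_of_le zero_le_one, sub_zero, one_smul]

/-- `‖(e^{−2πinQ})′‖ ≤ 2π|n|D₁`. [folklore] -/
theorem norm_deriv_cexp_mul_le (Q : ShearProfile) (n : ℤ) {D₁ : ℝ} (hD₁ : ∀ y, |deriv Q y| ≤ D₁) (y : ℝ) :
    ‖deriv (fun y : ℝ => Complex.exp (-(2 * Real.pi * I * n * Q y))) y‖ ≤ 2 * Real.pi * |(n : ℝ)| * D₁ := by
  rw [deriv_cexp_mul Q n]
  simp only
  rw [norm_mul, Complex.norm_exp]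
  have hre : (-(2 * Real.pi * I * n * (Q y : ℂ))).re = 0 := by
    simp [Complex.mul_re, Complex.I_re, Complex.I_im]
  rw [hre, Real.exp_zero, mul_one]
  simp only [norm_neg, norm_mul, Complex.norm_I, Complex.norm_intCast, Complex.norm_real, Complex.norm_ofNat,
    Real.norm_eq_abs, mul_one, abs_of_pos Real.pi_pos]
  exact mul_le_mul_of_nonneg_left (hD₁ y) (by positivity)

/-! ## The periodic-cell twist moment -/

/-- **Periodic-cell Sobolev–Wiener bound for the twist of a `1/N`-periodic profile.**  If `Q(y + 1/N) = Q(y)` (`N ≥ 1`),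
`|Q′| ≤ D₁`, `|Q″| ≤ D₂`, then for every `Q₀ ≥ 1`, with `A₁ = 2π|n|D₁`, `A₂ = 2π|n|D₂ + A₁²`:
`Σ_q |q_j|‖𝓕(x ↦ e^{−2πinQ(x_j)})(q)‖ ≤ (1/2π)(√(2Q₀)·A₁ + A₂/(N·π·√(2Q₀)))`, together with the two summabilities.
[cite: Grafakos2014, Prop. 3.1.2 (5) and Prop. 3.2.7 (3)] -/
theorem tsum_abs_mul_norm_mFourierCoeff_twist_le_periodic (Q : ShearProfile) (n : ℤ) (j : d) {N : ℕ} (hN : 1 ≤ N)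
    (hQN : ∀ y, Q (y + 1 / N) = Q y) {D₁ D₂ : ℝ} (hD₁ : ∀ y, |deriv Q y| ≤ D₁) (hD₂ : ∀ y, |deriv (deriv Q) y| ≤ D₂)
    {Q₀ : ℕ} (hQ₀ : 1 ≤ Q₀) :
    (Summable fun q : d → ℤ => ‖mFourierCoeff (fun x : UnitAddTorus d => twist Q n (x j)) q‖) ∧
    (Summable fun q : d → ℤ => |(q j : ℝ)| * ‖mFourierCoeff (fun x : UnitAddTorus d => twist Q n (x j)) q‖) ∧
    ∑' q : d → ℤ, |(q j : ℝ)| * ‖mFourierCoeff (fun x : UnitAddTorus d => twist Q n (x j)) q‖ ≤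
      1 / (2 * Real.pi) * (Real.sqrt (2 * Q₀) * (2 * Real.pi * |(n : ℝ)| * D₁) +
        (2 * Real.pi * |(n : ℝ)| * D₂ + (2 * Real.pi * |(n : ℝ)| * D₁) ^ 2) / ((N : ℝ) * (Real.pi * Real.sqrt (2 * Q₀)))) := by
  classical
  set F : ℝ → ℂ := fun y => Complex.exp (-(2 * Real.pi * I * n * Q y)) with hF
  have hFc : ContDiff ℝ ∞ F := Complex.contDiff_exp.comp ((contDiff_const.mul (ofRealCLM.contDiff.comp Q.contDiff)).neg)
  have hp0 : Function.Periodic F 1 := fun y => by simp only [hF, Q.periodic y]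
  have hp : ∀ α, Function.Periodic (iteratedDeriv α F) 1 := fun α => periodic_iteratedDeriv hp0 α
  have hd : ∀ α y, HasDerivAt (iteratedDeriv α F) (iteratedDeriv (α + 1) F y) y := by
    intro α y
    have hdiff : Differentiable ℝ (iteratedDeriv α F) := by
      rw [iteratedDeriv_eq_iterate]; exact (hFc.iterate_deriv α).differentiable (by simp)
    rw [iteratedDeriv_succ]
    exact (hdiff y).hasDerivAt
  have hcs : ∀ α, ContDiff ℝ ∞ (iteratedDeriv α F) := fun α => by
    rw [iteratedDeriv_eq_iterate]; exact hFc.iterate_deriv α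
  have hc : ∀ α, Continuous (iteratedDeriv α F) := fun α => (hcs α).continuous
  set Θ : ℕ → UnitAddTorus d → ℂ := fun α x => ((hp α).lift : UnitAddCircle → ℂ) (x j) with hΘ
  have hrel : ∀ α q, mFourierCoeff (Θ α) q = (2 * Real.pi * I * (q j : ℂ)) ^ α * mFourierCoeff (Θ 0) q :=
    fun α q => mFourierCoeff_comp_eval_periodicLift_iterate hp hd hc j α q
  have hΘ0 : Θ 0 = fun x : UnitAddTorus d => twist Q n (x j) := by
    funext x
    simp only [hΘ]
    induction x j using QuotientAddGroup.induction_on with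
    | H y => rw [(hp 0).lift_coe, iteratedDeriv_zero, twist_coe]
  have hsm0 : IsSmooth (Θ 0) := isSmooth_comp_eval_periodicLift (hp 0) (by rw [iteratedDeriv_zero]; exact hFc) j
  have haxis : ∀ (q : d → ℤ) (l : d), l ≠ j → q l ≠ 0 → mFourierCoeff (Θ 0) q = 0 := by
    intro q l hl hq
    have h := mFourierCoeff_comp_eval (G := ((hp 0).lift : UnitAddCircle → ℂ))
      (continuous_periodicLift (hc 0) (hp 0)) j q
    rw [if_neg (by push Not; exact ⟨l, hl, hq⟩)] at h
    exact h
  have hΘc : ∀ α, Continuous (Θ α) := fun α => (isSmooth_comp_eval_periodicLift (hp α) (hcs α) j).continuous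
  have h1 : ∀ q : d → ℤ, mFourierCoeff (Θ 1) q = (2 * Real.pi * I * (q j)) * mFourierCoeff (Θ 0) q := fun q => by
    rw [hrel 1 q, pow_one]
  have h2 : ∀ q : d → ℤ, mFourierCoeff (Θ 2) q = (2 * Real.pi * I * (q j)) * mFourierCoeff (Θ 1) q := fun q => by
    rw [hrel 2 q, hrel 1 q]; ring
  -- periodicity along the axis
  have hper : ∀ x : UnitAddTorus d, Θ 0 (x + Pi.single j (((1 : ℝ) / N : ℝ) : UnitAddCircle)) = Θ 0 x := by
    intro x
    simp only [hΘ, Pi.add_apply, Pi.single_eq_same]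
    induction x j using QuotientAddGroup.induction_on with
    | H y =>
      rw [← QuotientAddGroup.mk_add, (hp 0).lift_coe, (hp 0).lift_coe, iteratedDeriv_zero]
      simp only [hF, hQN]
  have hsupp : ∀ q : d → ℤ, mFourierCoeff (Θ 0) q ≠ 0 → (∀ l, l ≠ j → q l = 0) ∧ (N : ℤ) ∣ q j := by
    intro q hq
    refine ⟨fun l hl => ?_, ?_⟩
    · by_contra hq'; exact hq (haxis q l hl hq')
    · by_contra hdiv; exact hq (mFourierCoeff_eq_zero_of_axis_periodic hN hper hdiv)
  obtain ⟨hs, hle⟩ := tsum_moment_le_of_axis_periodic (hΘc 1) (hΘc 2) j hN hsupp h1 h2 (L := 1) zero_le_one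
    (fun q : d → ℤ => (abs_nonneg _ : (0 : ℝ) ≤ |((q j : ℤ) : ℝ)|))
    (fun q : d → ℤ => (le_of_eq (one_mul _).symm : |((q j : ℤ) : ℝ)| ≤ 1 * |((q j : ℤ) : ℝ)|)) hQ₀
  rw [hΘ0] at hs hle
  refine ⟨hΘ0 ▸ hsm0.rapidDecay_mFourierCoeff.summable_norm, hs, hle.trans ?_⟩
  -- the cell `L²` norms from the sup bounds
  have hA₁ : 0 ≤ 2 * Real.pi * |(n : ℝ)| * D₁ := by
    have : 0 ≤ D₁ := (abs_nonneg _).trans (hD₁ 0); positivity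
  have hA₂ : 0 ≤ 2 * Real.pi * |(n : ℝ)| * D₂ + (2 * Real.pi * |(n : ℝ)| * D₁) ^ 2 := by
    have : 0 ≤ D₂ := (abs_nonneg _).trans (hD₂ 0); positivity
  have hint : ∀ α, ∫ x : UnitAddTorus d, ‖Θ α x‖ ^ 2 = ∫ y in Ioc (0 : ℝ) 1, ‖iteratedDeriv α F y‖ ^ 2 := fun α => by
    simp only [hΘ]; exact integral_norm_sq_comp_eval_lift (hp α) (hc α) j
  have hI1 : ∫ x : UnitAddTorus d, ‖Θ 1 x‖ ^ 2 ≤ (2 * Real.pi * |(n : ℝ)| * D₁) ^ 2 := by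
    rw [hint 1, iteratedDeriv_one]
    exact setIntegral_Ioc_norm_sq_le (by rw [← iteratedDeriv_one]; exact hc 1) (norm_deriv_cexp_mul_le Q n hD₁)
  have hI2 : ∫ x : UnitAddTorus d, ‖Θ 2 x‖ ^ 2 ≤ (2 * Real.pi * |(n : ℝ)| * D₂ + (2 * Real.pi * |(n : ℝ)| * D₁) ^ 2) ^ 2 := by
    rw [hint 2]
    exact setIntegral_Ioc_norm_sq_le (hc 2) (norm_iteratedDeriv_two_cexp_mul_le Q n hD₁ hD₂)
  have hs1 : Real.sqrt (∫ x : UnitAddTorus d, ‖Θ 1 x‖ ^ 2) ≤ 2 * Real.pi * |(n : ℝ)| * D₁ := by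
    rw [← Real.sqrt_sq hA₁]; exact Real.sqrt_le_sqrt hI1
  have hs2 : Real.sqrt (∫ x : UnitAddTorus d, ‖Θ 2 x‖ ^ 2) ≤
      2 * Real.pi * |(n : ℝ)| * D₂ + (2 * Real.pi * |(n : ℝ)| * D₁) ^ 2 := by
    rw [← Real.sqrt_sq hA₂]; exact Real.sqrt_le_sqrt hI2
  have hQ0 : 0 < Real.sqrt (2 * Q₀) := Real.sqrt_pos.mpr (by positivity)
  gcongr

/-- Monotonicity of the periodic-cell twist bound in `|n|`. [folklore] -/
theorem twistMomentBound_periodic_mono {D₁ D₂ R₀ s N : ℝ} (hD₁ : 0 ≤ D₁) (hD₂ : 0 ≤ D₂) (hs : 0 < s) (hN : 0 < N)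
    {n : ℤ} (hn : |(n : ℝ)| < R₀) :
    1 / (2 * Real.pi) * (s * (2 * Real.pi * |(n : ℝ)| * D₁) +
        (2 * Real.pi * |(n : ℝ)| * D₂ + (2 * Real.pi * |(n : ℝ)| * D₁) ^ 2) / (N * (Real.pi * s))) ≤
      1 / (2 * Real.pi) * (s * (2 * Real.pi * R₀ * D₁) +
        (2 * Real.pi * R₀ * D₂ + (2 * Real.pi * R₀ * D₁) ^ 2) / (N * (Real.pi * s))) := by
  have hn' : |(n : ℝ)| ≤ R₀ := hn.le
  gcongr

/-! ## The residual shear is `1/N_j`-periodic -/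

omit [Fintype d] [DecidableEq d] in
/-- If `g` is continuous and `τ`-antiperiodic then `∫₀^{y+2τ} g = ∫₀^y g`. [folklore] -/
theorem intervalIntegral_add_two_mul_eq_of_antiperiodic {g : ℝ → ℝ} (hg : Continuous g) {τ : ℝ}
    (hτ : ∀ t, g (t + τ) = -g t) (y : ℝ) :
    ∫ t in (0 : ℝ)..(y + (τ + τ)), g t = ∫ t in (0 : ℝ)..y, g t := by
  have hint : ∀ a b, IntervalIntegrable g volume a b := fun a b => hg.intervalIntegrable _ _
  rw [← intervalIntegral.integral_add_adjacent_intervals (hint 0 y) (hint y (y + (τ + τ))),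
    ← intervalIntegral.integral_add_adjacent_intervals (hint y (y + τ)) (hint (y + τ) (y + (τ + τ)))]
  have h2 : ∫ t in (y + τ)..(y + (τ + τ)), g t = -∫ t in y..(y + τ), g t := by
    have h := intervalIntegral.integral_comp_add_right (a := y) (b := y + τ) g τ
    rw [show y + τ + τ = y + (τ + τ) by ring] at h
    rw [← h]
    simp only [hτ, intervalIntegral.integral_neg]
  rw [h2]; ring

variable (P : CascadeParams)

/-- **`Q_res(y + 1/N_j) = Q_res(y)`** for the residual integral `∫₀ʸ D_δ(U_j′)` (the slope defect is odd, `U_j′` is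
`1/(2N_j)`-antiperiodic). [cite: ElgindiLissMattingly2025, §1.2.2] -/
theorem residualShear_add_inv_N {j : ℕ} (hδj : 0 < P.δ j) (hN : P.N j ≠ 0) (δ y : ℝ) :
    (∫ t in (0 : ℝ)..(y + 1 / P.N j), ((1 - deriv (P.U j) t) * Real.smoothTransition ((deriv (P.U j) t - (1 - 2 * δ)) / δ) +
        (-1 - deriv (P.U j) t) * Real.smoothTransition ((-deriv (P.U j) t - (1 - 2 * δ)) / δ))) =
      ∫ t in (0 : ℝ)..y, ((1 - deriv (P.U j) t) * Real.smoothTransition ((deriv (P.U j) t - (1 - 2 * δ)) / δ) +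
        (-1 - deriv (P.U j) t) * Real.smoothTransition ((-deriv (P.U j) t - (1 - 2 * δ)) / δ)) := by
  have hN' : (P.N j : ℝ) ≠ 0 := Nat.cast_ne_zero.2 hN
  have hU'c : Continuous (deriv (P.U j)) := (P.contDiff_deriv_U hδj (n := ⊤)).continuous
  have hcont : Continuous (fun t => (1 - deriv (P.U j) t) * Real.smoothTransition ((deriv (P.U j) t - (1 - 2 * δ)) / δ) +
      (-1 - deriv (P.U j) t) * Real.smoothTransition ((-deriv (P.U j) t - (1 - 2 * δ)) / δ)) :=
    ((continuous_const.sub hU'c).mul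
      (Real.smoothTransition.continuous.comp ((hU'c.sub continuous_const).div_const _))).add
      ((continuous_const.sub hU'c).mul
        (Real.smoothTransition.continuous.comp ((hU'c.neg.sub continuous_const).div_const _)))
  rw [show y + 1 / (P.N j : ℝ) = y + (1 / (2 * P.N j) + 1 / (2 * P.N j)) by field_simp; ring]
  exact intervalIntegral_add_two_mul_eq_of_antiperiodic hcont (τ := 1 / (2 * P.N j))
    (fun t => by rw [deriv_U_add_half_period P hN t]; exact slopeCorr_neg δ (deriv (P.U j) t)) y

/-- **Periodic-cell twist moment of the residual shear, uniform on `|n| < R₀`** (socket `hTw` of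
`…ConcreteStepHMoments.cascade_ledger_step_H_concrete′`): for `Q_res(y) = −γ∫₀ʸ D_{3ε}(U_j′)` (`0 < ε ≤ 1/6`, `M ≥ 1`,
`e^{−M²/2} ≤ 6ε`, `γ ≥ 0`), every `Q₀ ≥ 1` and every `|n| < R₀`, with `D₁ = γ·6ε`, `D₂ = γ(2+8C₁)(M+4)Λ_j·3ε`:
`Σ_q |q_l|‖𝓕(twist Q_res n ∘ x_l)(q)‖ ≤ (1/2π)(√(2Q₀)·2πR₀D₁ + (2πR₀D₂ + (2πR₀D₁)²)/(N_jπ√(2Q₀)))`.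
[cite: Grafakos2014, Prop. 3.1.2 (5) and Prop. 3.2.7 (3)] -/
theorem twist_moment_residualShear_le_periodic (hγ : 0 ≤ P.γ) {j : ℕ} (hδj : 0 < P.δ j) (hN : P.N j ≠ 0)
    {ε M C₁ : ℝ} (hε : 0 < ε) (hε6 : ε ≤ 1 / 6) (hM : 1 ≤ M) (hMε : Real.exp (-(M ^ 2 / 2)) ≤ 2 * (3 * ε))
    (hC₁ : ∀ x, |deriv Real.smoothTransition x| ≤ C₁) (Qr : ShearProfile)
    (hQr : ∀ y, Qr y = -P.γ * ∫ t in (0 : ℝ)..y, ((1 - deriv (P.U j) t) *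
        Real.smoothTransition ((deriv (P.U j) t - (1 - 2 * (3 * ε))) / (3 * ε)) +
      (-1 - deriv (P.U j) t) * Real.smoothTransition ((-deriv (P.U j) t - (1 - 2 * (3 * ε))) / (3 * ε))))
    (l : d) {R₀ : ℝ} {Q₀ : ℕ} (hQ₀ : 1 ≤ Q₀) (n : ℤ) (hn : |(n : ℝ)| < R₀) :
    (Summable fun q : d → ℤ => ‖mFourierCoeff (fun x : UnitAddTorus d => twist Qr n (x l)) q‖) ∧
    (Summable fun q : d → ℤ => |(q l : ℝ)| * ‖mFourierCoeff (fun x : UnitAddTorus d => twist Qr n (x l)) q‖) ∧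
    ∑' q : d → ℤ, |(q l : ℝ)| * ‖mFourierCoeff (fun x : UnitAddTorus d => twist Qr n (x l)) q‖ ≤
      1 / (2 * Real.pi) * (Real.sqrt (2 * Q₀) * (2 * Real.pi * R₀ * (P.γ * (2 * (3 * ε)))) +
        (2 * Real.pi * R₀ * (P.γ * ((2 + 8 * C₁) * (M + 4) * (2 * Real.pi * P.N j / P.δ j) * (3 * ε))) +
          (2 * Real.pi * R₀ * (P.γ * (2 * (3 * ε)))) ^ 2) / ((P.N j : ℝ) * (Real.pi * Real.sqrt (2 * Q₀)))) := by
  have hQf : (⇑Qr : ℝ → ℝ) = fun y => -P.γ * ∫ t in (0 : ℝ)..y, ((1 - deriv (P.U j) t) *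
        Real.smoothTransition ((deriv (P.U j) t - (1 - 2 * (3 * ε))) / (3 * ε)) +
      (-1 - deriv (P.U j) t) * Real.smoothTransition ((-deriv (P.U j) t - (1 - 2 * (3 * ε))) / (3 * ε))) := funext hQr
  have hD1 : ∀ y, |deriv Qr y| ≤ P.γ * (2 * (3 * ε)) := fun y => by
    rw [hQf]; exact abs_deriv_residualShear_le P hγ hε hε6 hδj y
  have hD2 : ∀ y, |deriv (deriv Qr) y| ≤ P.γ * ((2 + 8 * C₁) * (M + 4) * (2 * Real.pi * P.N j / P.δ j) * (3 * ε)) :=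
    fun y => by rw [hQf]; exact abs_deriv_deriv_residualShear_le P hγ hε hε6 hM hMε hC₁ hδj hN y
  have hQN : ∀ y, Qr (y + 1 / P.N j) = Qr y := fun y => by rw [hQr, hQr, residualShear_add_inv_N P hδj hN]
  have hN1 : 1 ≤ P.N j := Nat.one_le_iff_ne_zero.mpr hN
  obtain ⟨h0, hs, hle⟩ := tsum_abs_mul_norm_mFourierCoeff_twist_le_periodic Qr n l hN1 hQN hD1 hD2 hQ₀
  have hC₁0 : 0 ≤ C₁ := (abs_nonneg _).trans (hC₁ 0)
  refine ⟨h0, hs, hle.trans (twistMomentBound_periodic_mono (by positivity) (by positivity)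
    (Real.sqrt_pos.mpr (by positivity)) (by exact_mod_cast hN1) hn)⟩

end Summit.AnomalousDissipation.AnomalousDissipation.Theorems.SawtoothPulseCascade.K1Slot
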